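import Mathlib.NumberTheory.LSeries.RiemannZeta
import Mathlib.NumberTheory.LSeries.Dirichlet
import Mathlib.NumberTheory.LSeries.Deriv
import Mathlib.NumberTheory.LSeries.SumCoeff
import Mathlib.NumberTheory.EulerProduct.DirichletLSeries
import Mathlib.NumberTheory.SumPrimeReciprocals
import Mathlib.NumberTheory.Chebyshev
import Mathlib.NumberTheory.ZetaValues
import Mathlib.NumberTheory.Harmonic.Bounds
import Mathlib.NumberTheory.Harmonic.ZetaAsymp
import Mathlib.Analysis.Real.Pi.Bounds
import Mathlib.Analysis.SpecialFunctions.Complex.LogBounds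
import Mathlib.Analysis.Complex.LocallyUniformLimit
import Literature.NumberTheory.LFunctions.ZetaRealAxis
import HarnessLib

/-!
# Prime logarithmic series: `∑ -log(1-1/p) p⁻ˢ`, `log ζ`, and `s ζ(1+s)`

Topic: `Literature/NumberTheory/LFunctions`. Analytic bookkeeping for the `Ω`-theorem behind
Robin's Prop. 1 of §4 (Robin 1984) = Lagarias's Prop. 3.2 (`Literature.NumberTheory.LFunctions.Robin1984_sigma_oscillation`),
after Nicolas (1983, Thm. 3 (c)): the Dirichlet series attached to Mertens' product
`∏_{p ≤ x} (1 - 1/p)⁻¹ = exp A(x)`, `A(x) = ∑_{p ≤ x} -log(1 - 1/p)`, and their relation to `log ζ`.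
Everything here is proved (no named facts).

## Main definitions and results

* `primeLogCoeff n = -log(1 - 1/n)` for `n` prime, `0` otherwise; `mertensLog x = A(x)`;
  `1/p ≤ a_p ≤ 1/(p-1)`, `A(x) ≤ 2 (1 + log x)`, `exp A(n) = ∏_{p ≤ n} (1 - 1/p)⁻¹`.
* `zetaOne s = s ζ(1+s)` (value `1` at `s = 0`), *defined* as Mathlib's `riemannZeta₁ (1 + s)`
  (`Mathlib.NumberTheory.Harmonic.ZetaAsymp`; hence entire, `differentiable_zetaOne`), real and
  positive on the real half-line `σ > -1` (`zetaOne_ofReal_pos`, using `ζ(σ) < 0` on `(0,1)` from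
  `ZetaRealAxis.lean` and Mathlib's `riemannZeta_pos_of_one_lt`), and in the slit plane for
  `Re s > 1` (`zetaOne_mem_slitPlane`).
* `primeZetaLog w = ∑_p -log(1 - p^{-w})` (the logarithm of the Euler product, Mathlib
  `riemannZeta_eulerProduct_exp_log`): holomorphic on `Re w > 1`, real on the real axis, and
  `log (zetaOne s) = log s + primeZetaLog (1+s)` for `Re s > 1` (`log_zetaOne_eq`).
* `primeLogDiff s = ∑_p (a_p p^{-s} + log(1 - p^{-1-s}))`: holomorphic on `Re s > -1/2`
  (`differentiableOn_primeLogDiff`), `primeLogDiff 0 = 0`, real on the real axis, and equal to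
  `LSeries a s - primeZetaLog (1+s)` for `Re s > 0` (`primeLogDiff_eq`).
* `primeLogLSeries_eq_mul_integral`: `LSeries a s = s ∫_1^∞ A(x) x^{-s-1} dx` (`Re s > 0`);
  `LSeries_vonMangoldt_eq_mul_integral_psi`: `-ζ'/ζ(s) = LSeries Λ s = s ∫_1^∞ ψ(x) x^{-s-1} dx`
  (`Re s > 1`), from Mathlib's `LSeries_eq_mul_integral`.

## References

* J.-L. Nicolas, *Petites valeurs de la fonction d'Euler*, J. Number Theory 17 (1983), 375–388,
  §4 (proof of Thm. 3 (c), formulas (21)–(23): the Mellin transforms behind `log ζ`,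
  `∑_p log(1 - 1/p) p^{-s}` and their comparison).
* G. Robin, *Grandes valeurs de la fonction somme des diviseurs et hypothèse de Riemann*, J. Math.
  Pures Appl. 63 (1984), 187–213, §4.
* H. L. Montgomery, R. C. Vaughan, *Multiplicative Number Theory I*, CUP 2007, §1.2 Thm. 1.3
  (partial summation for Dirichlet series), §1.3 (Euler products,
  `log ζ(s) = ∑ Λ(n)/(log n) n^{-s}`), §15.1.
-/

noncomputable section

open Complex Filter Topology Set MeasureTheory Finset

namespace Literature.NumberTheory.LFunctions

namespace Nicolas

/-! ### The coefficients `a_p = -log(1 - 1/p)` -/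

/-- `a_n = -log(1 - 1/n)` if `n` is prime, `0` otherwise, so that
`∑_{p ≤ x} a_p = log ∏_{p ≤ x} (1 - 1/p)⁻¹`. [cite: Nicolas1983, §4] -/
def primeLogCoeff (n : ℕ) : ℝ :=
  if n.Prime then -Real.log (1 - (n : ℝ)⁻¹) else 0

/-- Auxiliary (proof-internal). [folklore] -/
theorem primeLogCoeff_of_prime {p : ℕ} (hp : p.Prime) :
    primeLogCoeff p = -Real.log (1 - (p : ℝ)⁻¹) := if_pos hp

/-- Auxiliary (proof-internal). [folklore] -/
theorem primeLogCoeff_of_not_prime {n : ℕ} (hn : ¬ n.Prime) : primeLogCoeff n = 0 := if_neg hn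

/-- Auxiliary (proof-internal). [folklore] -/
@[simp] theorem primeLogCoeff_zero : primeLogCoeff 0 = 0 :=
  primeLogCoeff_of_not_prime Nat.not_prime_zero

/-- Auxiliary (proof-internal). [folklore] -/
@[simp] theorem primeLogCoeff_one : primeLogCoeff 1 = 0 :=
  primeLogCoeff_of_not_prime Nat.not_prime_one

/-- `1/p ≤ -log(1 - 1/p)`. [folklore] -/
theorem inv_le_primeLogCoeff {p : ℕ} (hp : p.Prime) : (p : ℝ)⁻¹ ≤ primeLogCoeff p := by
  rw [primeLogCoeff_of_prime hp]
  have hp2 : (2 : ℝ) ≤ p := by exact_mod_cast hp.two_le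
  have h1 : 0 < 1 - (p : ℝ)⁻¹ := by
    have : (p : ℝ)⁻¹ ≤ 1 / 2 := by rw [inv_eq_one_div]; gcongr
    linarith
  have := Real.log_le_sub_one_of_pos h1
  linarith

/-- `-log(1 - 1/p) ≤ 1/(p-1)`. [folklore] -/
theorem primeLogCoeff_le_inv_sub_one {p : ℕ} (hp : p.Prime) :
    primeLogCoeff p ≤ ((p : ℝ) - 1)⁻¹ := by
  rw [primeLogCoeff_of_prime hp]
  have hp2 : (2 : ℝ) ≤ p := by exact_mod_cast hp.two_le
  have hp0 : (0 : ℝ) < p := by linarith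
  have h1 : 0 < 1 - (p : ℝ)⁻¹ := by
    have : (p : ℝ)⁻¹ ≤ 1 / 2 := by rw [inv_eq_one_div]; gcongr
    linarith
  have h2 := Real.one_sub_inv_le_log_of_pos h1
  have hp1 : (p : ℝ) - 1 ≠ 0 := by linarith
  have h3 : (1 - (p : ℝ)⁻¹)⁻¹ = 1 + ((p : ℝ) - 1)⁻¹ := by
    field_simp
    ring
  linarith

/-- Auxiliary (proof-internal). [folklore] -/
theorem primeLogCoeff_nonneg (n : ℕ) : 0 ≤ primeLogCoeff n := by
  by_cases hn : n.Prime
  · exact le_trans (by positivity) (inv_le_primeLogCoeff hn)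
  · simp [primeLogCoeff_of_not_prime hn]

/-- `a_n ≤ 2/n`. [folklore] -/
theorem primeLogCoeff_le_two_div (n : ℕ) : primeLogCoeff n ≤ 2 / n := by
  by_cases hn : n.Prime
  · have hp2 : (2 : ℝ) ≤ n := by exact_mod_cast hn.two_le
    refine (primeLogCoeff_le_inv_sub_one hn).trans ?_
    rw [inv_eq_one_div, div_le_div_iff₀ (by linarith) (by linarith)]
    linarith
  · simp [primeLogCoeff_of_not_prime hn]; positivity

/-- Auxiliary (proof-internal). [folklore] -/
theorem abs_primeLogCoeff_le (n : ℕ) : |primeLogCoeff n| ≤ 2 / n := by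
  rw [abs_of_nonneg (primeLogCoeff_nonneg n)]
  exact primeLogCoeff_le_two_div n

/-- `0 ≤ a_p - 1/p ≤ 2/p²`. [folklore] -/
theorem abs_primeLogCoeff_sub_inv_le {p : ℕ} (hp : p.Prime) :
    |primeLogCoeff p - (p : ℝ)⁻¹| ≤ 2 / (p : ℝ) ^ 2 := by
  have hp2 : (2 : ℝ) ≤ p := by exact_mod_cast hp.two_le
  have hp0 : (0 : ℝ) < p := by linarith
  rw [abs_of_nonneg (by linarith [inv_le_primeLogCoeff hp])]
  have h1 := primeLogCoeff_le_inv_sub_one hp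
  have hp1 : (p : ℝ) - 1 ≠ 0 := by linarith
  have h2 : ((p : ℝ) - 1)⁻¹ - (p : ℝ)⁻¹ ≤ 2 / (p : ℝ) ^ 2 := by
    rw [show ((p : ℝ) - 1)⁻¹ - (p : ℝ)⁻¹ = 1 / ((p - 1) * p) by field_simp; ring]
    rw [div_le_div_iff₀ (by nlinarith) (by positivity)]
    nlinarith
  linarith

/-! ### Mertens' logarithmic sum `A(x) = ∑_{p ≤ x} -log(1 - 1/p)` -/

/-- `A(x) = ∑_{p ≤ x} -log(1 - 1/p) = log ∏_{p ≤ x} (1 - 1/p)⁻¹`, written as the summatory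
function `∑_{1 ≤ k ≤ ⌊x⌋} a_k` of `primeLogCoeff` (the shape of Mathlib's
`LSeries_eq_mul_integral`). [cite: Nicolas1983, §4] -/
def mertensLog (x : ℝ) : ℝ := ∑ k ∈ Icc 1 ⌊x⌋₊, primeLogCoeff k

/-- Auxiliary (proof-internal). [folklore] -/
theorem mertensLog_nonneg (x : ℝ) : 0 ≤ mertensLog x :=
  sum_nonneg fun k _ ↦ primeLogCoeff_nonneg k

/-- Auxiliary (proof-internal). [folklore] -/
theorem mertensLog_mono : Monotone mertensLog := by
  intro x y hxy
  apply sum_le_sum_of_subset_of_nonneg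
  · exact Icc_subset_Icc le_rfl (Nat.floor_le_floor hxy)
  · intro k _ _
    exact primeLogCoeff_nonneg k

/-- Auxiliary (proof-internal). [folklore] -/
theorem mertensLog_eq_natCast_floor (x : ℝ) : mertensLog x = mertensLog ⌊x⌋₊ := by
  simp [mertensLog]

/-- `A(n) = ∑_{p ≤ n} -log(1 - 1/p)`. [folklore] -/
theorem mertensLog_natCast (n : ℕ) :
    mertensLog n = ∑ p ∈ Nat.primesLE n, -Real.log (1 - (p : ℝ)⁻¹) := by
  rw [mertensLog, Nat.floor_natCast, Nat.primesLE_eq_filter_Icc_one, sum_filter]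
  refine sum_congr rfl fun k _ ↦ ?_
  by_cases hk : k.Prime
  · simp [hk, primeLogCoeff_of_prime hk]
  · simp [hk, primeLogCoeff_of_not_prime hk]

/-- `exp A(n) = ∏_{p ≤ n} (1 - 1/p)⁻¹` (Mertens' product). [folklore] -/
theorem exp_mertensLog_natCast (n : ℕ) :
    Real.exp (mertensLog n) = ∏ p ∈ Nat.primesLE n, (1 - (p : ℝ)⁻¹)⁻¹ := by
  rw [mertensLog_natCast, Real.exp_sum]
  refine prod_congr rfl fun p hp ↦ ?_
  have hp' := (Nat.mem_primesLE.1 hp).2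
  have hp2 : (2 : ℝ) ≤ p := by exact_mod_cast hp'.two_le
  have h1 : 0 < 1 - (p : ℝ)⁻¹ := by
    have : (p : ℝ)⁻¹ ≤ 1 / 2 := by rw [inv_eq_one_div]; gcongr
    linarith
  rw [Real.exp_neg, Real.exp_log h1]

/-- `A(x) ≤ 2 (1 + log x)` for `x ≥ 1` (from `a_k ≤ 2/k` and `H_n ≤ 1 + log n`). [folklore] -/
theorem mertensLog_le {x : ℝ} (hx : 1 ≤ x) : mertensLog x ≤ 2 * (1 + Real.log x) := by
  have h1 : mertensLog x ≤ ∑ k ∈ Icc 1 ⌊x⌋₊, 2 / (k : ℝ) :=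
    sum_le_sum fun k _ ↦ primeLogCoeff_le_two_div k
  have h2 : ∑ k ∈ Icc 1 ⌊x⌋₊, 2 / (k : ℝ) = 2 * (harmonic ⌊x⌋₊ : ℝ) := by
    rw [harmonic_eq_sum_Icc, Rat.cast_sum, mul_sum]
    refine sum_congr rfl fun k _ ↦ ?_
    simp [div_eq_mul_inv]
  have h3 : (harmonic ⌊x⌋₊ : ℝ) ≤ 1 + Real.log ⌊x⌋₊ := harmonic_le_one_add_log _
  have h4 : Real.log ⌊x⌋₊ ≤ Real.log x :=
    Real.log_le_log (by exact_mod_cast Nat.floor_pos.2 hx) (Nat.floor_le (by linarith))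
  linarith

/-- Auxiliary (proof-internal). [folklore] -/
theorem mertensLog_of_lt_one {x : ℝ} (hx : x < 1) : mertensLog x = 0 := by
  have : ⌊x⌋₊ = 0 := Nat.floor_eq_zero.2 hx
  simp [mertensLog, this]

/-- `|A(x)| ≤ 2 (1 + |log x|)` for all `x`. [folklore] -/
theorem abs_mertensLog_le (x : ℝ) : |mertensLog x| ≤ 2 * (1 + |Real.log x|) := by
  rw [abs_of_nonneg (mertensLog_nonneg x)]
  rcases lt_or_ge x 1 with hx | hx
  · rw [mertensLog_of_lt_one hx]; positivity
  · exact (mertensLog_le hx).trans (by gcongr; exact le_abs_self _)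

/-- Measurability of `A` (a function of `⌊x⌋`). [folklore] -/
theorem measurable_mertensLog : Measurable mertensLog := by
  have : mertensLog = (fun n : ℕ ↦ ∑ k ∈ Icc 1 n, primeLogCoeff k) ∘ Nat.floor := by
    funext x; simp [mertensLog]
  rw [this]
  exact (measurable_from_nat (f := fun n : ℕ ↦ ∑ k ∈ Icc 1 n, primeLogCoeff k)).comp
    Nat.measurable_floor

/-! ### `zetaOne s = s ζ(1+s) = riemannZeta₁ (1 + s)` -/

/-- `Z₁(s) = s ζ(1+s)` with its removable singularity at `s = 0` filled in by the value `1`; this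
is Mathlib's entire function `riemannZeta₁` (the completion of `(s-1) ζ(s)`,
`Mathlib.NumberTheory.Harmonic.ZetaAsymp`) translated by `1`: `zetaOne s = riemannZeta₁ (1 + s)`
by definition, so that all Mathlib facts about `riemannZeta₁` apply. [folklore] -/
def zetaOne (s : ℂ) : ℂ := riemannZeta₁ (1 + s)

/-- `zetaOne s = riemannZeta₁ (1 + s)` (definitional). [folklore] -/
theorem zetaOne_eq_riemannZeta₁ (s : ℂ) : zetaOne s = riemannZeta₁ (1 + s) := rfl

/-- `zetaOne s = s ζ(1+s)` for `s ≠ 0` (Mathlib `riemannZeta_eq_inv_sub_mul`). [folklore] -/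
theorem zetaOne_of_ne_zero {s : ℂ} (hs : s ≠ 0) : zetaOne s = s * riemannZeta (1 + s) := by
  have h1 : (1 : ℂ) + s ≠ 1 := by simpa using hs
  rw [zetaOne, riemannZeta_eq_inv_sub_mul h1, add_sub_cancel_left, ← mul_assoc,
    mul_inv_cancel₀ hs, one_mul]

/-- Auxiliary (proof-internal). [folklore] -/
@[simp] theorem zetaOne_zero : zetaOne 0 = 1 := by simp [zetaOne]

/-- `zetaOne` is entire (Mathlib `differentiable_riemannZeta₁`). [folklore] -/
theorem differentiable_zetaOne : Differentiable ℂ zetaOne :=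
  fun s ↦ (differentiable_riemannZeta₁ (1 + s)).comp s
    ((differentiable_const _).add differentiable_id s)

/-- Auxiliary (proof-internal). [folklore] -/
theorem continuous_zetaOne : Continuous zetaOne := differentiable_zetaOne.continuous

/-- Auxiliary (proof-internal). [folklore] -/
theorem analyticAt_zetaOne (s : ℂ) : AnalyticAt ℂ zetaOne s :=
  differentiable_zetaOne.analyticAt s

/-- `zetaOne s = 0 ↔ s ≠ 0 ∧ ζ(1+s) = 0`. [folklore] -/
theorem zetaOne_eq_zero_iff {s : ℂ} : zetaOne s = 0 ↔ s ≠ 0 ∧ riemannZeta (1 + s) = 0 := by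
  by_cases hs : s = 0
  · simp [hs]
  · simp [zetaOne_of_ne_zero hs, hs]

open scoped ComplexOrder in
/-- `zetaOne σ` is a positive real number for real `σ > -1`: for `σ > 0`, `ζ(1+σ) > 0`
(Mathlib); at `σ = 0` the value is `1`; for `-1 < σ < 0`, `σ < 0` and `ζ(1+σ) < 0`
(`Literature.NumberTheory.LFunctions.riemannZeta_neg_of_pos_of_lt_one`, Titchmarsh §2.12). [folklore] -/
theorem zetaOne_ofReal_pos {σ : ℝ} (hσ : -1 < σ) : 0 < zetaOne σ := by
  rcases lt_trichotomy σ 0 with h | h | h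
  · have hs : (σ : ℂ) ≠ 0 := by exact_mod_cast h.ne
    rw [zetaOne_of_ne_zero hs]
    have hz : riemannZeta ((1 + σ : ℝ) : ℂ) < 0 :=
      Literature.NumberTheory.LFunctions.riemannZeta_neg_of_pos_of_lt_one (by linarith) (by linarith)
    have hσ' : (σ : ℂ) < 0 := by exact_mod_cast h
    have := mul_pos_of_neg_of_neg hσ' hz
    simpa using this
  · subst h; simp
  · have hs : (σ : ℂ) ≠ 0 := by exact_mod_cast h.ne'
    rw [zetaOne_of_ne_zero hs]
    have hz : 0 < riemannZeta ((1 + σ : ℝ) : ℂ) := riemannZeta_pos_of_one_lt (by linarith)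
    have hσ' : (0 : ℂ) < σ := by exact_mod_cast h
    have := mul_pos hσ' hz
    simpa using this

/-- Real form: `zetaOne σ = r` for some real `r > 0`, when `σ > -1`. [folklore] -/
theorem zetaOne_ofReal_eq {σ : ℝ} (hσ : -1 < σ) : ∃ r : ℝ, 0 < r ∧ zetaOne σ = r := by
  have h := zetaOne_ofReal_pos hσ
  rw [Complex.pos_iff] at h
  refine ⟨(zetaOne σ).re, h.1, ?_⟩
  exact Complex.ext (by simp) (by simp [← h.2])

open scoped ComplexOrder in
/-- Auxiliary (proof-internal). [folklore] -/
theorem zetaOne_ofReal_ne_zero {σ : ℝ} (hσ : -1 < σ) : zetaOne σ ≠ 0 :=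
  (zetaOne_ofReal_pos hσ).ne'

/-- Auxiliary (proof-internal). [folklore] -/
theorem zetaOne_ofReal_mem_slitPlane {σ : ℝ} (hσ : -1 < σ) : zetaOne σ ∈ slitPlane := by
  obtain ⟨r, hr, h⟩ := zetaOne_ofReal_eq hσ
  rw [h]
  exact Complex.ofReal_mem_slitPlane.2 hr

/-! ### Prime powers `p^{-s}` -/

/-- `‖p^{-s}‖ = p^{-Re s}`. [folklore] -/
theorem norm_primes_cpow_neg (p : Nat.Primes) (s : ℂ) :
    ‖((p : ℕ) : ℂ) ^ (-s)‖ = ((p : ℕ) : ℝ) ^ (-s.re) := by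
  rw [norm_natCast_cpow_of_pos p.2.pos]
  simp

/-- Auxiliary (proof-internal). [folklore] -/
theorem norm_primes_cpow_neg_le (p : Nat.Primes) {s : ℂ} {η : ℝ} (hs : η ≤ s.re) :
    ‖((p : ℕ) : ℂ) ^ (-s)‖ ≤ ((p : ℕ) : ℝ) ^ (-η) := by
  rw [norm_primes_cpow_neg]
  have hp : (1 : ℝ) ≤ p := by exact_mod_cast p.2.one_lt.le
  exact Real.rpow_le_rpow_of_exponent_le hp (by linarith)

/-- `‖p^{-s}‖ ≤ 2^{-η} ≤ 1` and `< 1` when `Re s ≥ η > 0`. [folklore] -/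
theorem norm_primes_cpow_neg_le_two_rpow (p : Nat.Primes) {s : ℂ} {η : ℝ} (hη : 0 ≤ η)
    (hs : η ≤ s.re) : ‖((p : ℕ) : ℂ) ^ (-s)‖ ≤ (2 : ℝ) ^ (-η) := by
  refine (norm_primes_cpow_neg_le p hs).trans ?_
  have hp : (2 : ℝ) ≤ p := by exact_mod_cast p.2.two_le
  exact Real.rpow_le_rpow_of_nonpos (by norm_num) hp (by linarith)

/-- Auxiliary (proof-internal). [folklore] -/
theorem norm_primes_cpow_neg_lt_one (p : Nat.Primes) {s : ℂ} (hs : 0 < s.re) :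
    ‖((p : ℕ) : ℂ) ^ (-s)‖ < 1 := by
  rw [norm_primes_cpow_neg]
  have hp : (1 : ℝ) < p := by exact_mod_cast p.2.one_lt
  exact Real.rpow_lt_one_of_one_lt_of_neg hp (by linarith)

/-- Auxiliary (proof-internal). [folklore] -/
theorem one_sub_primes_cpow_neg_mem_slitPlane (p : Nat.Primes) {s : ℂ} (hs : 0 < s.re) :
    1 - ((p : ℕ) : ℂ) ^ (-s) ∈ slitPlane := by
  rw [sub_eq_add_neg]
  exact mem_slitPlane_of_norm_lt_one (by rw [norm_neg]; exact norm_primes_cpow_neg_lt_one p hs)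

/-- For real `σ`, `p^{-σ}` is the real number `p^{-σ}`. [folklore] -/
theorem primes_cpow_neg_ofReal (p : Nat.Primes) (σ : ℝ) :
    ((p : ℕ) : ℂ) ^ (-(σ : ℂ)) = ((((p : ℕ) : ℝ) ^ (-σ) : ℝ) : ℂ) := by
  rw [ofReal_cpow (Nat.cast_nonneg _)]
  simp

/-- Auxiliary (proof-internal). [folklore] -/
theorem differentiable_primes_cpow_neg (p : Nat.Primes) :
    Differentiable ℂ (fun s : ℂ ↦ ((p : ℕ) : ℂ) ^ (-s)) := by
  intro s
  refine DifferentiableAt.const_cpow differentiableAt_id.neg (Or.inl ?_)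
  exact_mod_cast p.2.ne_zero

/-! ### `primeZetaLog w = ∑_p -log(1 - p^{-w}) = log ζ(w)` -/

/-- The logarithm of the Euler product, `∑_p -log(1 - p^{-w})` (`Re w > 1`), Mathlib's
`riemannZeta_eulerProduct_exp_log`. [cite: MontgomeryVaughan2007, §1.3] -/
def primeZetaLog (w : ℂ) : ℂ := ∑' p : Nat.Primes, -Complex.log (1 - ((p : ℕ) : ℂ) ^ (-w))

/-- `exp (primeZetaLog w) = ζ(w)` for `Re w > 1` (Mathlib). [cite: MontgomeryVaughan2007, §1.3] -/
theorem exp_primeZetaLog {w : ℂ} (hw : 1 < w.re) : exp (primeZetaLog w) = riemannZeta w :=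
  riemannZeta_eulerProduct_exp_log hw

/-- Termwise bound: `‖log(1 - p^{-w})‖ ≤ (3/2) p^{-η}` for `Re w ≥ η ≥ 1`. [folklore] -/
theorem norm_log_one_sub_primes_cpow_le (p : Nat.Primes) {w : ℂ} {η : ℝ} (hη : 1 ≤ η)
    (hw : η ≤ w.re) :
    ‖-Complex.log (1 - ((p : ℕ) : ℂ) ^ (-w))‖ ≤ 3 / 2 * ((p : ℕ) : ℝ) ^ (-η) := by
  rw [norm_neg, sub_eq_add_neg]
  have h1 : ‖-((p : ℕ) : ℂ) ^ (-w)‖ ≤ 1 / 2 := by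
    rw [norm_neg]
    refine (norm_primes_cpow_neg_le_two_rpow p (by linarith) hw).trans ?_
    calc (2 : ℝ) ^ (-η) ≤ (2 : ℝ) ^ (-1 : ℝ) :=
          Real.rpow_le_rpow_of_exponent_le (by norm_num) (by linarith)
      _ = 1 / 2 := by norm_num
  refine (norm_log_one_add_half_le_self h1).trans ?_
  rw [norm_neg]
  gcongr
  exact norm_primes_cpow_neg_le p hw

/-- Auxiliary (proof-internal). [folklore] -/
theorem summable_primes_rpow_neg {η : ℝ} (hη : 1 < η) :
    Summable fun p : Nat.Primes ↦ ((p : ℕ) : ℝ) ^ (-η) :=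
  Nat.Primes.summable_rpow.2 (by linarith)

/-- `primeZetaLog` is holomorphic on `Re w > 1`. [folklore] -/
theorem differentiableOn_primeZetaLog : DifferentiableOn ℂ primeZetaLog {w : ℂ | 1 < w.re} := by
  intro w hw
  simp only [Set.mem_setOf_eq] at hw
  set η : ℝ := (1 + w.re) / 2 with hη
  have hη1 : 1 < η := by rw [hη]; linarith
  have hU : IsOpen {w : ℂ | η < w.re} := isOpen_lt continuous_const continuous_re
  have hwU : w ∈ {w : ℂ | η < w.re} := by simp only [Set.mem_setOf_eq, hη]; linarith
  have hd : DifferentiableOn ℂ primeZetaLog {w : ℂ | η < w.re} := by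
    refine differentiableOn_tsum_of_summable_norm (u := fun p : Nat.Primes ↦
      3 / 2 * ((p : ℕ) : ℝ) ^ (-η)) ((summable_primes_rpow_neg hη1).mul_left _) ?_ hU ?_
    · intro p z hz
      simp only [Set.mem_setOf_eq] at hz
      refine ((differentiable_primes_cpow_neg p z).const_sub 1).clog ?_ |>.neg.differentiableWithinAt
      exact one_sub_primes_cpow_neg_mem_slitPlane p (by linarith)
    · intro p z hz
      exact norm_log_one_sub_primes_cpow_le p hη1.le (le_of_lt hz)
  exact (hd.differentiableAt (hU.mem_nhds hwU)).differentiableWithinAt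

/-- Auxiliary (proof-internal). [folklore] -/
theorem summable_primeZetaLog {w : ℂ} (hw : 1 < w.re) :
    Summable fun p : Nat.Primes ↦ -Complex.log (1 - ((p : ℕ) : ℂ) ^ (-w)) := by
  refine Summable.of_norm_bounded ((summable_primes_rpow_neg hw).mul_left (3 / 2)) ?_
  intro p
  exact norm_log_one_sub_primes_cpow_le p hw.le le_rfl

/-- On the real axis `primeZetaLog` is real: `primeZetaLog x = ∑_p -log(1 - p^{-x})` (real
logarithms), `x > 1`. [folklore] -/
theorem primeZetaLog_ofReal {x : ℝ} (hx : 1 < x) :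
    primeZetaLog x = ((∑' p : Nat.Primes, -Real.log (1 - ((p : ℕ) : ℝ) ^ (-x)) : ℝ) : ℂ) := by
  rw [primeZetaLog, ofReal_tsum]
  refine tsum_congr fun p ↦ ?_
  have hp : (0 : ℝ) < 1 - ((p : ℕ) : ℝ) ^ (-x) := by
    have h1 : ((p : ℕ) : ℝ) ^ (-x) < 1 :=
      Real.rpow_lt_one_of_one_lt_of_neg (by exact_mod_cast p.2.one_lt) (by linarith)
    linarith
  rw [primes_cpow_neg_ofReal, ofReal_neg, ofReal_log hp.le]
  simp

/-- Auxiliary (proof-internal). [folklore] -/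
theorem primeZetaLog_ofReal_im {x : ℝ} (hx : 1 < x) : (primeZetaLog x).im = 0 := by
  rw [primeZetaLog_ofReal hx, ofReal_im]

/-! ### `ζ(w)` is close to `1` for `Re w ≥ 2` -/

/-- `‖ζ(w) - 1‖ ≤ π²/6 - 1` for `Re w ≥ 2` (compare with `ζ(2)`). [folklore] -/
theorem norm_riemannZeta_sub_one_le {w : ℂ} (hw : 2 ≤ w.re) :
    ‖riemannZeta w - 1‖ ≤ Real.pi ^ 2 / 6 - 1 := by
  have hw1 : 1 < w.re := by linarith
  have hsum : Summable fun n : ℕ ↦ 1 / ((n : ℂ) + 1) ^ w := by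
    have := (Complex.summable_one_div_nat_cpow.2 hw1)
    exact (summable_nat_add_iff 1).2 this |>.congr fun n ↦ by simp
  have h1 : riemannZeta w - 1 = ∑' n : ℕ, 1 / ((n : ℂ) + 2) ^ w := by
    rw [zeta_eq_tsum_one_div_nat_add_one_cpow hw1, hsum.tsum_eq_zero_add]
    simp only [Nat.cast_zero, zero_add, one_cpow, div_one, add_sub_cancel_left]
    refine tsum_congr fun n ↦ ?_
    congr 2
    push_cast
    ring
  have h2 : ∀ n : ℕ, ‖1 / ((n : ℂ) + 2) ^ w‖ ≤ 1 / ((n : ℝ) + 2) ^ 2 := by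
    intro n
    have hn : (0 : ℝ) < n + 2 := by positivity
    rw [norm_div, norm_one, show ((n : ℂ) + 2) = ((n + 2 : ℕ) : ℂ) by push_cast; ring,
      norm_natCast_cpow_of_pos (by omega), show ((n + 2 : ℕ) : ℝ) = n + 2 by push_cast; ring]
    rw [← Real.rpow_natCast _ 2]
    gcongr
    · linarith
    · exact_mod_cast hw
  have h3 : HasSum (fun n : ℕ ↦ 1 / ((n : ℝ) + 2) ^ 2) (Real.pi ^ 2 / 6 - 1) := by
    have h := (hasSum_nat_add_iff' 2).2 hasSum_zeta_two
    have he : (fun n : ℕ ↦ 1 / ((n : ℝ) + 2) ^ 2) = fun n : ℕ ↦ 1 / ((n + 2 : ℕ) : ℝ) ^ 2 := by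
      funext n; push_cast; ring
    have hv : Real.pi ^ 2 / 6 - 1 = Real.pi ^ 2 / 6 - ∑ i ∈ range 2, 1 / ((i : ℝ)) ^ 2 := by
      simp [Finset.sum_range_succ]
    rw [he, hv]; exact h
  rw [h1]
  exact tsum_of_norm_bounded h3 h2

/-- `Re ζ(w) > 0` for `Re w ≥ 2`. [folklore] -/
theorem riemannZeta_re_pos_of_two_le {w : ℂ} (hw : 2 ≤ w.re) : 0 < (riemannZeta w).re := by
  have h := norm_riemannZeta_sub_one_le hw
  have hpi : Real.pi ^ 2 / 6 - 1 < 1 := by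
    have := Real.pi_lt_d2
    nlinarith [Real.pi_pos]
  have h2 : |(riemannZeta w - 1).re| < 1 :=
    lt_of_le_of_lt ((abs_re_le_norm _).trans h) hpi
  rw [sub_re, one_re, abs_lt] at h2
  linarith [h2.1]

/-- The product of two numbers with positive real part lies in the slit plane. [folklore] -/
theorem mul_mem_slitPlane_of_re_pos {z w : ℂ} (hz : 0 < z.re) (hw : 0 < w.re) :
    z * w ∈ slitPlane := by
  rw [mem_slitPlane_iff]
  by_contra h
  push Not at h
  obtain ⟨hre, him⟩ := h
  simp only [mul_re, mul_im] at hre him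
  -- `z.re * w.im = - z.im * w.re`, so `w.im = - z.im * w.re / z.re`
  have hwim : w.im = -(z.im * w.re) / z.re := by
    field_simp
    linarith
  rw [hwim] at hre
  have : z.re * w.re - z.im * (-(z.im * w.re) / z.re) = w.re * (z.re ^ 2 + z.im ^ 2) / z.re := by
    field_simp
    ring
  rw [this] at hre
  have : 0 < w.re * (z.re ^ 2 + z.im ^ 2) / z.re := by positivity
  linarith

/-- `zetaOne s = s ζ(1+s)` lies in the slit plane for `Re s > 1`. [folklore] -/
theorem zetaOne_mem_slitPlane {s : ℂ} (hs : 1 < s.re) : zetaOne s ∈ slitPlane := by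
  have hs0 : s ≠ 0 := by rintro rfl; norm_num at hs
  rw [zetaOne_of_ne_zero hs0]
  refine mul_mem_slitPlane_of_re_pos (by linarith) (riemannZeta_re_pos_of_two_le ?_)
  simp only [add_re, one_re]
  linarith

/-- Auxiliary (proof-internal). [folklore] -/
theorem isOpen_re_gt' (a : ℝ) : IsOpen {s : ℂ | a < s.re} :=
  isOpen_lt continuous_const continuous_re

/-- Auxiliary (proof-internal). [folklore] -/
theorem isPreconnected_re_gt (a : ℝ) : IsPreconnected {s : ℂ | a < s.re} :=
  (convex_halfSpace_re_gt a).isPreconnected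

/-- Real points `> a` are frequent in the punctured neighbourhood of a real point `x > a` of `ℂ`
(used to pass identities from the real axis to a half-plane by the identity theorem). [folklore] -/
theorem frequently_ofReal_gt {a x : ℝ} (hx : a < x) {P : ℂ → Prop}
    (h : ∀ y : ℝ, a < y → P y) : ∃ᶠ z in 𝓝[≠] (x : ℂ), P z := by
  have ht : Tendsto (fun y : ℝ ↦ (y : ℂ)) (𝓝[≠] x) (𝓝[≠] (x : ℂ)) := by
    refine tendsto_nhdsWithin_of_tendsto_nhds_of_eventually_within _
      (Complex.continuous_ofReal.tendsto x |>.mono_left nhdsWithin_le_nhds) ?_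
    filter_upwards [self_mem_nhdsWithin] with y hy
    simpa using hy
  have hev : ∀ᶠ y : ℝ in 𝓝[≠] x, P y := by
    have : ∀ᶠ y : ℝ in 𝓝 x, a < y := (isOpen_lt continuous_const continuous_id).mem_nhds hx
    filter_upwards [nhdsWithin_le_nhds this] with y hy
    exact h y hy
  exact ht.frequently hev.frequently

/-- **`log (s ζ(1+s)) = log s + ∑_p -log(1 - p^{-1-s})`** for `Re s > 1` (principal logarithms):
both sides are holomorphic on the half-plane, real on the real axis, and have the same
exponential `s ζ(1+s)` (Euler product), so they agree on the real axis and hence everywhere.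
[cite: MontgomeryVaughan2007, §1.3] -/
theorem log_zetaOne_eq {s : ℂ} (hs : 1 < s.re) :
    Complex.log (zetaOne s) = Complex.log s + primeZetaLog (1 + s) := by
  -- the real case
  have hreal : ∀ y : ℝ, 1 < y →
      Complex.log (zetaOne y) = Complex.log y + primeZetaLog (1 + y) := by
    intro y hy
    have hy0 : (y : ℂ) ≠ 0 := by exact_mod_cast (show y ≠ 0 by linarith)
    obtain ⟨r, hr, hzr⟩ := zetaOne_ofReal_eq (σ := y) (by linarith)
    have hexp : exp (Complex.log (zetaOne y)) = exp (Complex.log y + primeZetaLog (1 + y)) := by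
      rw [exp_log (by rw [hzr]; exact_mod_cast hr.ne'), exp_add, exp_log hy0,
        show (1 : ℂ) + y = ((1 + y : ℝ) : ℂ) by push_cast; ring,
        exp_primeZetaLog (by simp; linarith), zetaOne_of_ne_zero hy0]
      push_cast
      ring_nf
    obtain ⟨n, hn⟩ := exp_eq_exp_iff_exists_int.1 hexp
    -- imaginary parts: both sides are real, so `n = 0`
    have him := congrArg Complex.im hn
    rw [hzr, ← ofReal_log hr.le, ofReal_im, add_im, add_im, ← ofReal_log (by linarith),
      ofReal_im, show (1 : ℂ) + y = ((1 + y : ℝ) : ℂ) by push_cast; ring,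
      primeZetaLog_ofReal_im (by linarith)] at him
    simp only [zero_add, mul_im, intCast_re, intCast_im, zero_mul, add_zero, mul_re,
      re_ofNat, ofReal_re, im_ofNat, ofReal_im, mul_zero, sub_zero, I_im, mul_one, I_re] at him
    have hn0 : (n : ℝ) = 0 := by
      have : (n : ℝ) * (2 * Real.pi) = 0 := by linarith
      rcases mul_eq_zero.1 this with h | h
      · exact h
      · linarith [Real.pi_pos]
    have hn0' : n = 0 := by exact_mod_cast hn0
    rw [hn, hn0']
    simp
  -- analyticity of both sides on the half-plane
  set U : Set ℂ := {s : ℂ | 1 < s.re} with hU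
  have hUo : IsOpen U := isOpen_re_gt' 1
  have hf : AnalyticOnNhd ℂ (fun s ↦ Complex.log (zetaOne s)) U := by
    refine DifferentiableOn.analyticOnNhd (fun z hz ↦ ?_) hUo
    exact ((differentiable_zetaOne z).clog (zetaOne_mem_slitPlane hz)).differentiableWithinAt
  have hg : AnalyticOnNhd ℂ (fun s ↦ Complex.log s + primeZetaLog (1 + s)) U := by
    refine DifferentiableOn.analyticOnNhd (fun z hz ↦ ?_) hUo
    simp only [hU, Set.mem_setOf_eq] at hz
    refine DifferentiableAt.differentiableWithinAt ?_
    refine (differentiableAt_id.clog ?_).add ?_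
    · exact Or.inl (by simp; linarith)
    · have h1 : DifferentiableAt ℂ primeZetaLog (1 + z) :=
        differentiableOn_primeZetaLog.differentiableAt ((isOpen_re_gt' 1).mem_nhds (by simp; linarith))
      exact h1.comp z ((differentiableAt_const _).add differentiableAt_id)
  have h2U : ((2 : ℝ) : ℂ) ∈ U := by simp [hU]
  have hfreq : ∃ᶠ z in 𝓝[≠] ((2 : ℝ) : ℂ),
      Complex.log (zetaOne z) = Complex.log z + primeZetaLog (1 + z) :=
    frequently_ofReal_gt (a := 1) (by norm_num) hreal
  exact hf.eqOn_of_preconnected_of_frequently_eq hg (isPreconnected_re_gt 1) h2U hfreq hs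

/-! ### `primeLogDiff s = ∑_p (a_p p^{-s} + log(1 - p^{-1-s}))` -/

/-- The `p`-th term `a_p p^{-s} + log(1 - p^{-1-s})` of `primeLogDiff`. [cite: Nicolas1983, §4] -/
def primeLogDiffTerm (p : Nat.Primes) (s : ℂ) : ℂ :=
  (primeLogCoeff p : ℂ) * ((p : ℕ) : ℂ) ^ (-s) + Complex.log (1 - ((p : ℕ) : ℂ) ^ (-(1 + s)))

/-- `D(s) = ∑_p (a_p p^{-s} + log(1 - p^{-1-s}))`, the difference between the Dirichlet series of
`a_p = -log(1 - 1/p)` and `log ζ(1+s)`; it converges absolutely for `Re s > -1/2`.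
[cite: Nicolas1983, §4] -/
def primeLogDiff (s : ℂ) : ℂ := ∑' p : Nat.Primes, primeLogDiffTerm p s

/-- `p^{-s} = p · p^{-(1+s)}`. [folklore] -/
theorem primes_cpow_neg_eq_mul (p : Nat.Primes) (s : ℂ) :
    ((p : ℕ) : ℂ) ^ (-s) = ((p : ℕ) : ℂ) * ((p : ℕ) : ℂ) ^ (-(1 + s)) := by
  have hp : ((p : ℕ) : ℂ) ≠ 0 := by exact_mod_cast p.2.ne_zero
  rw [show -s = 1 + (-(1 + s)) by ring, cpow_add _ _ hp, cpow_one]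

/-- Termwise bound for `primeLogDiff`: for `Re s ≥ -1/2 + η`, `0 < η`,
`‖a_p p^{-s} + log(1 - p^{-1-s})‖ ≤ 2 p^{-(3/2 + η)} + 2 p^{-(1 + 2η)}`. Proof:
`a_p p^{-s} + log(1 - z) = (p a_p - 1) z + (z + log(1 - z))` with `z = p^{-1-s}`,
`|p a_p - 1| ≤ 2/p` and `‖z + log(1 - z)‖ ≤ 2 ‖z‖²` (`‖z‖ ≤ 3/4`). [cite: Nicolas1983, §4] -/
theorem norm_primeLogDiffTerm_le (p : Nat.Primes) {s : ℂ} {η : ℝ} (hη : 0 < η)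
    (hs : -1 / 2 + η ≤ s.re) :
    ‖primeLogDiffTerm p s‖ ≤
      2 * ((p : ℕ) : ℝ) ^ (-(3 / 2 + η)) + 2 * ((p : ℕ) : ℝ) ^ (-(1 + 2 * η)) := by
  set z : ℂ := ((p : ℕ) : ℂ) ^ (-(1 + s)) with hz
  have hp2 : (2 : ℝ) ≤ p := by exact_mod_cast p.2.two_le
  have hp0 : (0 : ℝ) < p := by linarith
  have hzn : ‖z‖ = ((p : ℕ) : ℝ) ^ (-(1 + s.re)) := by
    rw [hz, norm_primes_cpow_neg]; simp
  have hzle : ‖z‖ ≤ ((p : ℕ) : ℝ) ^ (-(1 / 2 + η)) := by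
    rw [hzn]
    exact Real.rpow_le_rpow_of_exponent_le (by linarith) (by linarith)
  have hz34 : ‖z‖ ≤ 3 / 4 := by
    refine hzle.trans ?_
    calc ((p : ℕ) : ℝ) ^ (-(1 / 2 + η)) ≤ ((p : ℕ) : ℝ) ^ (-(1 / 2 : ℝ)) :=
          Real.rpow_le_rpow_of_exponent_le (by linarith) (by linarith)
      _ ≤ (2 : ℝ) ^ (-(1 / 2 : ℝ)) := Real.rpow_le_rpow_of_nonpos (by norm_num) hp2 (by norm_num)
      _ ≤ 3 / 4 := by
          rw [Real.rpow_neg (by norm_num), ← Real.sqrt_eq_rpow]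
          rw [inv_le_comm₀ (Real.sqrt_pos.2 (by norm_num)) (by norm_num)]
          rw [Real.le_sqrt (by norm_num) (by norm_num)]
          norm_num
  have hz1 : ‖z‖ < 1 := by linarith
  -- decomposition
  have hdec : primeLogDiffTerm p s =
      ((p : ℂ) * (primeLogCoeff p : ℂ) - 1) * z + (Complex.log (1 + (-z)) - (-z)) := by
    rw [primeLogDiffTerm, primes_cpow_neg_eq_mul, ← hz]
    ring_nf
  -- the two bounds
  have hA : ‖((p : ℂ) * (primeLogCoeff p : ℂ) - 1) * z‖ ≤ 2 * ((p : ℕ) : ℝ) ^ (-(3 / 2 + η)) := by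
    rw [norm_mul]
    have h1 : ‖(p : ℂ) * (primeLogCoeff p : ℂ) - 1‖ ≤ 2 / p := by
      have hpC : ((p : ℕ) : ℂ) ≠ 0 := by exact_mod_cast p.2.ne_zero
      have : (p : ℂ) * (primeLogCoeff p : ℂ) - 1 = (((p : ℝ) * (primeLogCoeff p - (p : ℝ)⁻¹) : ℝ) : ℂ) := by
        push_cast
        field_simp
      rw [this, Complex.norm_real, Real.norm_eq_abs, abs_mul, abs_of_pos hp0]
      have h2 := abs_primeLogCoeff_sub_inv_le p.2
      calc (p : ℝ) * |primeLogCoeff p - (p : ℝ)⁻¹| ≤ p * (2 / (p : ℝ) ^ 2) := by gcongr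
        _ = 2 / p := by field_simp
    calc ‖(p : ℂ) * (primeLogCoeff p : ℂ) - 1‖ * ‖z‖
        ≤ 2 / p * ((p : ℕ) : ℝ) ^ (-(1 / 2 + η)) := by gcongr
      _ = 2 * ((p : ℕ) : ℝ) ^ (-(3 / 2 + η)) := by
          rw [show -(3 / 2 + η) = -1 + (-(1 / 2 + η)) by ring, Real.rpow_add hp0,
            Real.rpow_neg_one]
          ring
  have hB : ‖Complex.log (1 + (-z)) - (-z)‖ ≤ 2 * ((p : ℕ) : ℝ) ^ (-(1 + 2 * η)) := by
    have h1 := norm_log_one_add_sub_self_le (z := -z) (by rwa [norm_neg])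
    rw [norm_neg] at h1
    have h2 : (1 - ‖z‖)⁻¹ ≤ 4 := by
      rw [inv_le_comm₀ (by linarith) (by norm_num)]
      linarith
    have h3 : ‖z‖ ^ 2 ≤ ((p : ℕ) : ℝ) ^ (-(1 + 2 * η)) := by
      calc ‖z‖ ^ 2 ≤ (((p : ℕ) : ℝ) ^ (-(1 / 2 + η))) ^ 2 := by gcongr
        _ = ((p : ℕ) : ℝ) ^ (-(1 + 2 * η)) := by
            rw [← Real.rpow_natCast, ← Real.rpow_mul hp0.le]
            norm_num
            ring_nf
    calc ‖Complex.log (1 + (-z)) - (-z)‖ ≤ ‖z‖ ^ 2 * (1 - ‖z‖)⁻¹ / 2 := h1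
      _ ≤ ((p : ℕ) : ℝ) ^ (-(1 + 2 * η)) * 4 / 2 := by gcongr
      _ = 2 * ((p : ℕ) : ℝ) ^ (-(1 + 2 * η)) := by ring
  rw [hdec]
  exact (norm_add_le _ _).trans (add_le_add hA hB)

/-- Auxiliary (proof-internal). [folklore] -/
theorem summable_norm_primeLogDiffTerm_bound {η : ℝ} (hη : 0 < η) :
    Summable fun p : Nat.Primes ↦
      2 * ((p : ℕ) : ℝ) ^ (-(3 / 2 + η)) + 2 * ((p : ℕ) : ℝ) ^ (-(1 + 2 * η)) :=
  ((summable_primes_rpow_neg (by linarith)).mul_left 2).add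
    ((summable_primes_rpow_neg (by linarith)).mul_left 2)

/-- Auxiliary (proof-internal). [folklore] -/
theorem differentiable_primeLogDiffTerm (p : Nat.Primes) :
    DifferentiableOn ℂ (primeLogDiffTerm p) {s : ℂ | -1 / 2 < s.re} := by
  intro s hs
  simp only [Set.mem_setOf_eq] at hs
  refine DifferentiableAt.differentiableWithinAt ?_
  refine ((differentiable_primes_cpow_neg p s).const_mul _).add ?_
  have h1 : DifferentiableAt ℂ (fun s : ℂ ↦ ((p : ℕ) : ℂ) ^ (-(1 + s))) s := by
    have := (differentiable_primes_cpow_neg p).comp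
      ((differentiable_const (1 : ℂ)).add differentiable_id)
    exact this s
  refine (h1.const_sub 1).clog ?_
  exact one_sub_primes_cpow_neg_mem_slitPlane p (by simp; linarith)

/-- `primeLogDiff` is holomorphic on `Re s > -1/2`. [cite: Nicolas1983, §4] -/
theorem differentiableOn_primeLogDiff : DifferentiableOn ℂ primeLogDiff {s : ℂ | -1 / 2 < s.re} := by
  intro s hs
  simp only [Set.mem_setOf_eq] at hs
  set η : ℝ := (s.re + 1 / 2) / 2 with hη
  have hη0 : 0 < η := by rw [hη]; linarith
  have hU : IsOpen {z : ℂ | -1 / 2 + η < z.re} := isOpen_re_gt' _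
  have hsU : s ∈ {z : ℂ | -1 / 2 + η < z.re} := by simp only [Set.mem_setOf_eq, hη]; linarith
  have hd : DifferentiableOn ℂ primeLogDiff {z : ℂ | -1 / 2 + η < z.re} := by
    refine differentiableOn_tsum_of_summable_norm (summable_norm_primeLogDiffTerm_bound hη0)
      ?_ hU ?_
    · intro p
      exact (differentiable_primeLogDiffTerm p).mono fun z hz ↦ by
        simp only [Set.mem_setOf_eq] at hz ⊢; linarith
    · intro p z hz
      exact norm_primeLogDiffTerm_le p hη0 (le_of_lt hz)
  exact (hd.differentiableAt (hU.mem_nhds hsU)).differentiableWithinAt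

/-- Auxiliary (proof-internal). [folklore] -/
theorem summable_primeLogDiffTerm {s : ℂ} (hs : -1 / 2 < s.re) :
    Summable fun p : Nat.Primes ↦ primeLogDiffTerm p s := by
  set η : ℝ := (s.re + 1 / 2) / 2 with hη
  have hη0 : 0 < η := by rw [hη]; linarith
  refine Summable.of_norm_bounded (summable_norm_primeLogDiffTerm_bound hη0) fun p ↦ ?_
  exact norm_primeLogDiffTerm_le p hη0 (by rw [hη]; linarith)

/-- `primeLogDiff 0 = 0` (each term is `-log(1 - 1/p) + log(1 - 1/p)`). [cite: Nicolas1983, §4] -/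
theorem primeLogDiff_zero : primeLogDiff 0 = 0 := by
  rw [primeLogDiff]
  convert tsum_zero with p
  rw [primeLogDiffTerm, neg_zero, cpow_zero, mul_one, add_zero, primeLogCoeff_of_prime p.2]
  have hp2 : (2 : ℝ) ≤ p := by exact_mod_cast p.2.two_le
  have h1 : (0 : ℝ) ≤ 1 - ((p : ℕ) : ℝ)⁻¹ := by
    have : ((p : ℕ) : ℝ)⁻¹ ≤ 1 / 2 := by rw [inv_eq_one_div]; gcongr
    linarith
  have h2 : (1 : ℂ) - ((p : ℕ) : ℂ) ^ (-(1 : ℂ)) = ((1 - ((p : ℕ) : ℝ)⁻¹ : ℝ) : ℂ) := by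
    rw [cpow_neg_one]
    push_cast
    rfl
  rw [h2, ← ofReal_log h1]
  push_cast
  ring

/-- On the real axis `primeLogDiff` is real (`σ > -1/2`). [folklore] -/
theorem primeLogDiff_ofReal_im {σ : ℝ} (hσ : -1 / 2 < σ) : (primeLogDiff σ).im = 0 := by
  rw [primeLogDiff, Complex.im_tsum (summable_primeLogDiffTerm (by simpa using hσ))]
  convert tsum_zero with p
  rw [primeLogDiffTerm, primes_cpow_neg_ofReal,
    show (1 : ℂ) + σ = ((1 + σ : ℝ) : ℂ) by push_cast; ring, primes_cpow_neg_ofReal]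
  have h1 : (0 : ℝ) ≤ 1 - ((p : ℕ) : ℝ) ^ (-(1 + σ)) := by
    have : ((p : ℕ) : ℝ) ^ (-(1 + σ)) < 1 :=
      Real.rpow_lt_one_of_one_lt_of_neg (by exact_mod_cast p.2.one_lt) (by linarith)
    linarith
  rw [show (1 : ℂ) - ((((p : ℕ) : ℝ) ^ (-(1 + σ)) : ℝ) : ℂ) = ((1 - ((p : ℕ) : ℝ) ^ (-(1 + σ)) : ℝ) : ℂ)
    by push_cast; ring, ← ofReal_log h1]
  simp

/-! ### The Dirichlet series `∑ a_n n^{-s}` and integral representations -/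

/-- `LSeries a s = ∑_p -log(1 - 1/p) p^{-s}`, absolutely convergent for `Re s > 0`.
[cite: Nicolas1983, §4] -/
def primeLogLSeries (s : ℂ) : ℂ := LSeries (fun n ↦ (primeLogCoeff n : ℂ)) s

/-- Auxiliary (proof-internal). [folklore] -/
theorem LSeriesSummable_primeLogCoeff {s : ℂ} (hs : 0 < s.re) :
    LSeriesSummable (fun n ↦ (primeLogCoeff n : ℂ)) s := by
  refine LSeriesSummable_of_le_const_mul_rpow (x := 0) hs ⟨2, fun n hn ↦ ?_⟩
  rw [Complex.norm_real, Real.norm_eq_abs]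
  refine (abs_primeLogCoeff_le n).trans (le_of_eq ?_)
  rw [zero_sub, Real.rpow_neg_one]
  ring

/-- Auxiliary (proof-internal). [folklore] -/
theorem abscissaOfAbsConv_primeLogCoeff_le :
    LSeries.abscissaOfAbsConv (fun n ↦ (primeLogCoeff n : ℂ)) ≤ 0 :=
  LSeries.abscissaOfAbsConv_le_of_forall_lt_LSeriesSummable fun y hy ↦
    LSeriesSummable_primeLogCoeff (by simpa using hy)

/-- `primeLogLSeries` is holomorphic on `Re s > 0`. [folklore] -/
theorem differentiableOn_primeLogLSeries : DifferentiableOn ℂ primeLogLSeries {s : ℂ | 0 < s.re} := by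
  refine (LSeries_differentiableOn _).mono fun s hs ↦ ?_
  simp only [Set.mem_setOf_eq] at hs ⊢
  exact lt_of_le_of_lt abscissaOfAbsConv_primeLogCoeff_le (by exact_mod_cast hs)

/-- `primeLogLSeries s = ∑_p a_p p^{-s}` as a sum over primes. [folklore] -/
theorem primeLogLSeries_eq_tsum_primes (s : ℂ) :
    primeLogLSeries s = ∑' p : Nat.Primes, (primeLogCoeff p : ℂ) * ((p : ℕ) : ℂ) ^ (-s) := by
  rw [primeLogLSeries, LSeries]
  have h1 : ∀ n : ℕ, LSeries.term (fun n ↦ (primeLogCoeff n : ℂ)) s n =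
      (primeLogCoeff n : ℂ) * (n : ℂ) ^ (-s) := by
    intro n
    rcases eq_or_ne n 0 with rfl | hn
    · simp
    · rw [LSeries.term_of_ne_zero hn, cpow_neg, div_eq_mul_inv]
  simp_rw [h1]
  symm
  refine (Function.Injective.tsum_eq (g := fun p : Nat.Primes ↦ (p : ℕ))
    (f := fun n : ℕ ↦ (primeLogCoeff n : ℂ) * (n : ℂ) ^ (-s)) ?_ ?_)
  · exact fun p q h ↦ Subtype.ext h
  · intro n hn
    rw [Function.mem_support] at hn
    have hp : n.Prime := by
      by_contra h
      exact hn (by simp [primeLogCoeff_of_not_prime h])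
    exact ⟨⟨n, hp⟩, rfl⟩

/-- **`primeLogDiff s = primeLogLSeries s - primeZetaLog (1+s)`** for `Re s > 0`.
[cite: Nicolas1983, §4] -/
theorem primeLogDiff_eq {s : ℂ} (hs : 0 < s.re) :
    primeLogDiff s = primeLogLSeries s - primeZetaLog (1 + s) := by
  have h1 : Summable fun p : Nat.Primes ↦ (primeLogCoeff p : ℂ) * ((p : ℕ) : ℂ) ^ (-s) := by
    have := (summable_primeLogDiffTerm (s := s) (by linarith)).sub
      (summable_primeZetaLog (w := 1 + s) (by simp; linarith)).neg
    refine this.congr fun p ↦ ?_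
    simp [primeLogDiffTerm]
  rw [primeLogLSeries_eq_tsum_primes s, primeZetaLog, sub_eq_add_neg, ← tsum_neg,
    ← (h1.tsum_add (summable_primeZetaLog (w := 1 + s) (by simp; linarith)).neg)]
  refine tsum_congr fun p ↦ ?_
  simp [primeLogDiffTerm]

/-- **Integral representation** `∑ a_n n^{-s} = s ∫_1^∞ A(x) x^{-s-1} dx` for `Re s > 0`
(partial summation, Mathlib `LSeries_eq_mul_integral`; `A(x) = O(log x)`).
[cite: MontgomeryVaughan2007, §1.2, Thm. 1.3] -/
theorem primeLogLSeries_eq_mul_integral {s : ℂ} (hs : 0 < s.re) :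
    primeLogLSeries s = s * ∫ t in Ioi (1 : ℝ), (mertensLog t : ℂ) * (t : ℂ) ^ (-(s + 1)) := by
  have hr : (0 : ℝ) ≤ s.re / 2 := by linarith
  have hO : (fun n : ℕ ↦ ∑ k ∈ Icc 1 n, (primeLogCoeff k : ℂ)) =O[atTop]
      fun n ↦ (n : ℝ) ^ (s.re / 2) := by
    have h1 : (fun n : ℕ ↦ ∑ k ∈ Icc 1 n, (primeLogCoeff k : ℂ)) =O[atTop]
        fun n ↦ 2 * (1 + Real.log n) := by
      refine Asymptotics.IsBigO.of_bound 1 ?_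
      filter_upwards [eventually_ge_atTop 1] with n hn
      rw [← ofReal_sum, Complex.norm_real, Real.norm_eq_abs, one_mul, Real.norm_eq_abs]
      have h := mertensLog_le (x := n) (by exact_mod_cast hn)
      rw [mertensLog, Nat.floor_natCast] at h
      rw [abs_of_nonneg (sum_nonneg fun k _ ↦ primeLogCoeff_nonneg k)]
      exact h.trans (le_abs_self _)
    refine h1.trans ?_
    have h2 : (fun x : ℝ ↦ 2 * (1 + Real.log x)) =O[atTop] fun x ↦ x ^ (s.re / 2) := by
      refine Asymptotics.IsBigO.const_mul_left (Asymptotics.IsBigO.add ?_ ?_) 2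
      · refine Asymptotics.IsBigO.of_bound 1 ?_
        filter_upwards [eventually_ge_atTop 1] with x hx
        rw [Real.norm_eq_abs, Real.norm_eq_abs, abs_one, one_mul,
          abs_of_pos (Real.rpow_pos_of_pos (by linarith) _)]
        exact Real.one_le_rpow hx (by linarith)
      · exact (isLittleO_log_rpow_atTop (by linarith)).isBigO
    exact h2.comp_tendsto tendsto_natCast_atTop_atTop
  have h := LSeries_eq_mul_integral (fun n ↦ (primeLogCoeff n : ℂ)) hr (by linarith)
    (LSeriesSummable_primeLogCoeff hs) hO
  rw [primeLogLSeries, h]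
  congr 1
  refine setIntegral_congr_fun measurableSet_Ioi fun t _ ↦ ?_
  rw [mertensLog, ofReal_sum]

/-- `ψ(n) = ∑_{1 ≤ k ≤ n} Λ(k)`. [folklore] -/
theorem psi_natCast_eq_sum_Icc (n : ℕ) :
    Chebyshev.psi n = ∑ k ∈ Icc 1 n, ArithmeticFunction.vonMangoldt k := by
  rw [Chebyshev.psi, Nat.floor_natCast]
  rfl

/-- **Integral representation** `-ζ'(s)/ζ(s) = ∑ Λ(n) n^{-s} = s ∫_1^∞ ψ(x) x^{-s-1} dx` for
`Re s > 1` (Mathlib `LSeries_vonMangoldt_eq_deriv_riemannZeta_div`, `LSeries_eq_mul_integral`,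
`Chebyshev.psi_le_const_mul_self`). [cite: MontgomeryVaughan2007, §1.2, Thm. 1.3] -/
theorem LSeries_vonMangoldt_eq_mul_integral_psi {s : ℂ} (hs : 1 < s.re) :
    LSeries (fun n ↦ (ArithmeticFunction.vonMangoldt n : ℂ)) s =
      s * ∫ t in Ioi (1 : ℝ), (Chebyshev.psi t : ℂ) * (t : ℂ) ^ (-(s + 1)) := by
  have hO : (fun n : ℕ ↦ ∑ k ∈ Icc 1 n, (ArithmeticFunction.vonMangoldt k : ℂ)) =O[atTop]
      fun n ↦ (n : ℝ) ^ (1 : ℝ) := by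
    refine Asymptotics.IsBigO.of_bound (Real.log 4 + 4) ?_
    filter_upwards [eventually_ge_atTop 1] with n hn
    rw [← ofReal_sum, ← psi_natCast_eq_sum_Icc, Complex.norm_real, Real.norm_eq_abs,
      abs_of_nonneg (Chebyshev.psi_nonneg _), Real.norm_eq_abs, Real.rpow_one,
      abs_of_nonneg (Nat.cast_nonneg _)]
    exact Chebyshev.psi_le_const_mul_self (Nat.cast_nonneg _)
  have h := LSeries_eq_mul_integral (fun n ↦ (ArithmeticFunction.vonMangoldt n : ℂ)) zero_le_one
    hs (ArithmeticFunction.LSeriesSummable_vonMangoldt hs) hO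
  rw [h]
  congr 1
  refine setIntegral_congr_fun measurableSet_Ioi fun t _ ↦ ?_
  rw [Chebyshev.psi_eq_psi_coe_floor, psi_natCast_eq_sum_Icc, ofReal_sum]

/-- `-ζ'(s)/ζ(s) = s ∫_1^∞ ψ(x) x^{-s-1} dx` for `Re s > 1` (the previous lemma combined with
Mathlib's `LSeries_vonMangoldt_eq_deriv_riemannZeta_div`).
[cite: MontgomeryVaughan2007, §1.2, Thm. 1.3] -/
theorem neg_deriv_riemannZeta_div_eq_mul_integral_psi {s : ℂ} (hs : 1 < s.re) :
    -deriv riemannZeta s / riemannZeta s =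
      s * ∫ t in Ioi (1 : ℝ), (Chebyshev.psi t : ℂ) * (t : ℂ) ^ (-(s + 1)) := by
  rw [← LSeries_vonMangoldt_eq_mul_integral_psi hs]
  exact (ArithmeticFunction.LSeries_vonMangoldt_eq_deriv_riemannZeta_div hs).symm

end Nicolas

end Literature.NumberTheory.LFunctions

end
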